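import Mathlib

set_option linter.dupNamespace false
set_option linter.unusedSectionVars false

/-!
# LabelPreparationA (lens 4, g29; (P9) glue steps (g1) + (g2) of the (c0) road) — PUNCTURING AND RELABELLING THE LABEL CODE

Blocker `X = AbsorptionDial.NoPerfectPolyOdd` (item 28487); decomp-qadv lens 4, g29.  The register `g₀` of face (c0) reads the labels
`Λ u ∈ 𝔽_p^k` (and one quadratic value).  Two bookkeeping facts used by the (P9) glue in front of `ColumnBridgeB.loss_of_freeDisperse_prepared`:

* (g2) RELABELLING `relabel`: for a change of label basis `G` with a left inverse (`G′ G = 1`, rectangular allowed) the same register is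
  `u ↦ H′(GΛ u, q u)` with `H′ = H ∘ G′`; so the label rows may be replaced by any spanning family of their row space (`labelOf_mul`).
* (g2′) PREPARED BASIS `exists_prepared_basis`: for a prepared `U₀` the rows re-base (`k′ + k″ = k`, `G′ G = 1`) as `GΛ = Λf ⧺ Λv`, `Λv`
  vanishing off `U₀`, every non-zero `Λf`-combination of weight `≥ w₀` off `U₀` (`Submodule.exists_isCompl` + `Module.finBasis` of
  `V = vanSub Λ U₀` and of a complement `W`; `V ⊓ W = ⊥` and the linear independence of the `W`-basis give the weight clause).
* (g1) PUNCTURING `exists_puncture` (the set `U₀(Λ)` of NODE-g27 (x)(b) / REFEREE-66v65 (P9)): for every threshold `w₀` there is a set `U₀` of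
  at most `k·w₀` coordinates such that EVERY label combination `aᵀΛ` either vanishes off `U₀` or has weight `≥ w₀` off `U₀`.  Proof: the
  combinations vanishing off `U` form a subspace `vanSub Λ U ≤ 𝔽_p^k`; while some combination is non-zero but light off `U`, add its off-`U`
  support (`< w₀` points): the subspace grows STRICTLY (`puncture_step`), so by `Submodule.finrank_lt_finrank_of_lt` this happens at most
  `k = finrank 𝔽_p^k` times (`puncture_from`, induction on the co-dimension budget).

Supports stmt-QuantumAdvantage-28487 (record; the residual `X` is NOT claimed).
-/

open Finset

namespace Summit.QuantumAdvantage.QuantumAdvantage.Theorems.LabelPreparation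

variable {p : ℕ} [Fact p.Prime] {n k : ℕ}

/-- the label vector `Λ u = (Σ_{u i} Λ j i)_j` of an input -/
def labelOf (Λ : Fin k → Fin n → ZMod p) (u : Fin n → Bool) : Fin k → ZMod p :=
  fun j => ∑ i, if u i = true then Λ j i else 0

/-- labels are linear in the label rows: `(GΛ) u = G · (Λ u)` -/
theorem labelOf_mul {k₂ : ℕ} (G : Matrix (Fin k₂) (Fin k) (ZMod p)) (Λ : Fin k → Fin n → ZMod p) (u : Fin n → Bool) :
    labelOf (fun j i => ∑ l, G j l * Λ l i) u = G.mulVec (labelOf Λ u) := by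
  funext j
  simp only [labelOf, Matrix.mulVec, dotProduct]
  have hL : ∀ x, (if u x = true then ∑ l, G j l * Λ l x else 0) = ∑ l, (if u x = true then G j l * Λ l x else 0) := by
    intro x
    split_ifs <;> simp
  simp_rw [hL]
  rw [Finset.sum_comm]
  refine sum_congr rfl fun l _ => ?_
  rw [mul_sum]
  refine sum_congr rfl fun x _ => ?_
  split_ifs <;> simp

/-- **(g2) RELABELLING.**  A register reading `H(Λ u, q u)` reads `H′((GΛ) u, q u)` with `H′ v = H (G′ v)` whenever `G′ G = 1`
(`G` may be rectangular: any spanning family of label combinations will do). -/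
theorem relabel {α β : Type*} {k₂ : ℕ} (y : (Fin n → Bool) → α) (q : (Fin n → Bool) → β) (H : (Fin k → ZMod p) → β → α)
    (Λ : Fin k → Fin n → ZMod p) (hy : ∀ u, y u = H (labelOf Λ u) (q u))
    (G : Matrix (Fin k₂) (Fin k) (ZMod p)) (G' : Matrix (Fin k) (Fin k₂) (ZMod p)) (hGG : G' * G = 1) (u : Fin n → Bool) :
    y u = (fun v z => H (G'.mulVec v) z) (labelOf (fun j i => ∑ l, G j l * Λ l i) u) (q u) := by
  simp only [labelOf_mul, Matrix.mulVec_mulVec, hGG, Matrix.one_mulVec]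
  exact hy u

section Puncture

variable (Λ : Fin k → Fin n → ZMod p)

/-- the combination `aᵀΛ` at coordinate `i` -/
def combAt (a : Fin k → ZMod p) (i : Fin n) : ZMod p := ∑ j, a j * Λ j i

/-- the label combinations vanishing off `U`, a subspace of `𝔽_p^k` -/
def vanSub (U : Finset (Fin n)) : Submodule (ZMod p) (Fin k → ZMod p) where
  carrier := {a | ∀ i, i ∉ U → combAt Λ a i = 0}
  add_mem' := by
    intro a b ha hb i hi
    have h1 := ha i hi
    have h2 := hb i hi
    simp only [combAt, Pi.add_apply, add_mul, sum_add_distrib] at h1 h2 ⊢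
    rw [h1, h2, add_zero]
  zero_mem' := by
    intro i _
    simp [combAt]
  smul_mem' := by
    intro c a ha i hi
    have h1 := ha i hi
    simp only [combAt, Pi.smul_apply, smul_eq_mul, mul_assoc, ← mul_sum] at h1 ⊢
    rw [h1, mul_zero]

/-- membership in the vanishing subspace -/
theorem mem_vanSub {U : Finset (Fin n)} {a : Fin k → ZMod p} : a ∈ vanSub Λ U ↔ ∀ i, i ∉ U → combAt Λ a i = 0 := Iff.rfl

/-- enlarging `U` enlarges the vanishing subspace -/
theorem vanSub_mono {U V : Finset (Fin n)} (hUV : U ⊆ V) : vanSub Λ U ≤ vanSub Λ V := by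
  intro a ha i hi
  exact ha i fun h => hi (hUV h)

/-- the off-`U` weight of the combination `aᵀΛ` -/
noncomputable def wtOff (U : Finset (Fin n)) (a : Fin k → ZMod p) : ℕ :=
  (univ.filter fun i => i ∉ U ∧ combAt Λ a i ≠ 0).card

/-- `U` is PREPARED at threshold `w₀`: every combination vanishes off `U` or has off-`U` weight `≥ w₀` -/
def Prepared (w₀ : ℕ) (U : Finset (Fin n)) : Prop :=
  ∀ a : Fin k → ZMod p, (∀ i, i ∉ U → combAt Λ a i = 0) ∨ w₀ ≤ wtOff Λ U a

/-- one puncturing step: a non-vanishing light combination lets `U` grow by `< w₀` points with a STRICTLY larger vanishing subspace -/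
theorem puncture_step (w₀ : ℕ) (U : Finset (Fin n)) (hU : ¬ Prepared Λ w₀ U) :
    ∃ U' : Finset (Fin n), U ⊆ U' ∧ U'.card ≤ U.card + w₀ ∧ vanSub Λ U < vanSub Λ U' := by
  classical
  unfold Prepared at hU
  push Not at hU
  obtain ⟨a, hnv, hlt⟩ := hU
  refine ⟨U ∪ univ.filter (fun i => i ∉ U ∧ combAt Λ a i ≠ 0), subset_union_left, ?_, ?_⟩
  · calc (U ∪ univ.filter (fun i => i ∉ U ∧ combAt Λ a i ≠ 0)).card
          ≤ U.card + (univ.filter (fun i => i ∉ U ∧ combAt Λ a i ≠ 0)).card := card_union_le _ _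
      _ ≤ U.card + w₀ := by unfold wtOff at hlt; omega
  · refine lt_of_le_of_ne (vanSub_mono Λ subset_union_left) fun heq => ?_
    have ha' : a ∈ vanSub Λ (U ∪ univ.filter (fun i => i ∉ U ∧ combAt Λ a i ≠ 0)) := by
      intro i hi
      rw [mem_union, not_or, mem_filter] at hi
      by_contra hne
      exact hi.2 ⟨mem_univ i, hi.1, hne⟩
    rw [← heq] at ha'
    obtain ⟨i, hiU, hne⟩ := hnv
    exact hne (ha' i hiU)

/-- the induction on the co-dimension budget `d ≥ k − finrank (vanSub Λ U)` -/
theorem puncture_from (w₀ : ℕ) :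
    ∀ (d : ℕ) (U : Finset (Fin n)), k ≤ d + Module.finrank (ZMod p) (vanSub Λ U) →
      ∃ U₀ : Finset (Fin n), U ⊆ U₀ ∧ U₀.card ≤ U.card + d * w₀ ∧ Prepared Λ w₀ U₀ := by
  intro d
  induction d with
  | zero =>
      intro U hk
      refine ⟨U, subset_rfl, by simp, ?_⟩
      by_contra hU
      obtain ⟨U', -, -, hlt⟩ := puncture_step Λ w₀ U hU
      have h1 := Submodule.finrank_lt_finrank_of_lt hlt
      have h2 : Module.finrank (ZMod p) (vanSub Λ U') ≤ k := by
        have := Submodule.finrank_le (vanSub Λ U')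
        rwa [Module.finrank_fintype_fun_eq_card, Fintype.card_fin] at this
      omega
  | succ d ih =>
      intro U hk
      by_cases hU : Prepared Λ w₀ U
      · exact ⟨U, subset_rfl, by simp, hU⟩
      · obtain ⟨U', hUU', hcard, hlt⟩ := puncture_step Λ w₀ U hU
        have h1 := Submodule.finrank_lt_finrank_of_lt hlt
        obtain ⟨U₀, hU'U₀, hcard₀, hprep⟩ := ih U' (by omega)
        refine ⟨U₀, hUU'.trans hU'U₀, ?_, hprep⟩
        calc U₀.card ≤ U'.card + d * w₀ := hcard₀
          _ ≤ U.card + w₀ + d * w₀ := by omega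
          _ = U.card + (d + 1) * w₀ := by ring

/-- **(g1) PUNCTURING.**  Some `U₀` with `|U₀| ≤ k·w₀` is prepared at threshold `w₀`: every label combination `aᵀΛ` vanishes off `U₀` or has
at least `w₀` non-zero coordinates off `U₀`. -/
theorem exists_puncture (w₀ : ℕ) :
    ∃ U₀ : Finset (Fin n), U₀.card ≤ k * w₀ ∧
      ∀ a : Fin k → ZMod p, (∀ i, i ∉ U₀ → (∑ j, a j * Λ j i) = 0) ∨
        w₀ ≤ (univ.filter fun i => i ∉ U₀ ∧ (∑ j, a j * Λ j i) ≠ 0).card := by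
  obtain ⟨U₀, -, hcard, hprep⟩ := puncture_from Λ w₀ k ∅ (by omega)
  refine ⟨U₀, by simpa using hcard, ?_⟩
  exact hprep

/-- a combination of combinations: `combAt Λ (Σ_q a′_q • row_q) i = Σ_q a′_q · combAt Λ row_q i` -/
theorem combAt_sum {k' : ℕ} (row : Fin k' → Fin k → ZMod p) (a' : Fin k' → ZMod p) (i : Fin n) :
    combAt Λ (fun l => ∑ q, a' q * row q l) i = ∑ q, a' q * combAt Λ (row q) i := by
  simp only [combAt]
  simp_rw [sum_mul, mul_sum]
  rw [sum_comm]
  refine sum_congr rfl fun q _ => sum_congr rfl fun l _ => ?_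
  ring

/-- **(g2′) PREPARED BASIS.**  If `U₀` is prepared at threshold `w₀`, the label rows can be re-based (`G′ G = 1`, `k′ + k″ = k`) as
`GΛ = Λf ⧺ Λv` with the `k″` rows `Λv` VANISHING off `U₀` and every non-zero combination of the `k′` rows `Λf` of weight `≥ w₀` off `U₀`
(`V = vanSub Λ U₀`, `W` a complement, `Λv` / `Λf` the combinations along bases of `V` / `W`). -/
theorem exists_prepared_basis (w₀ : ℕ) (U₀ : Finset (Fin n)) (hprep : Prepared Λ w₀ U₀) :
    ∃ (k' k'' : ℕ) (Λf : Fin k' → Fin n → ZMod p) (Λv : Fin k'' → Fin n → ZMod p)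
      (G : Matrix (Fin (k' + k'')) (Fin k) (ZMod p)) (G' : Matrix (Fin k) (Fin (k' + k'')) (ZMod p)),
      k' + k'' = k ∧ G' * G = 1 ∧ (fun j i => ∑ l, G j l * Λ l i) = Fin.append Λf Λv ∧
      (∀ j i, i ∉ U₀ → Λv j i = 0) ∧
      (∀ a' : Fin k' → ZMod p, a' ≠ 0 → w₀ ≤ (univ.filter fun i => i ∉ U₀ ∧ (∑ q, a' q * Λf q i) ≠ 0).card) := by
  classical
  obtain ⟨W, hVW⟩ := Submodule.exists_isCompl (vanSub Λ U₀)
  let bV := Module.finBasis (ZMod p) (vanSub Λ U₀)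
  let bW := Module.finBasis (ZMod p) W
  let rowW : Fin (Module.finrank (ZMod p) W) → Fin k → ZMod p := fun q => ((bW q : W) : Fin k → ZMod p)
  let rowV : Fin (Module.finrank (ZMod p) (vanSub Λ U₀)) → Fin k → ZMod p := fun j => ((bV j : vanSub Λ U₀) : Fin k → ZMod p)
  -- every vector is a combination of the rows
  have hsumW : ∀ c : Fin (Module.finrank (ZMod p) W) → ZMod p,
      (∑ q, c q • rowW q) = ((∑ q, c q • bW q : W) : Fin k → ZMod p) := by
    intro c
    rw [Submodule.coe_sum]
    refine sum_congr rfl fun q _ => ?_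
    rw [Submodule.coe_smul]
  have hsumV : ∀ c : Fin (Module.finrank (ZMod p) (vanSub Λ U₀)) → ZMod p,
      (∑ j, c j • rowV j) = ((∑ j, c j • bV j : vanSub Λ U₀) : Fin k → ZMod p) := by
    intro c
    rw [Submodule.coe_sum]
    refine sum_congr rfl fun j _ => ?_
    rw [Submodule.coe_smul]
  have hdec : ∀ x : Fin k → ZMod p, ∃ (cW : Fin (Module.finrank (ZMod p) W) → ZMod p)
      (cV : Fin (Module.finrank (ZMod p) (vanSub Λ U₀)) → ZMod p), (∑ q, cW q • rowW q) + ∑ j, cV j • rowV j = x := by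
    intro x
    have hx : x ∈ vanSub Λ U₀ ⊔ W := by
      rw [hVW.sup_eq_top]
      exact Submodule.mem_top
    obtain ⟨y, hy, z, hz, hyz⟩ := Submodule.mem_sup.mp hx
    refine ⟨fun q => bW.repr ⟨z, hz⟩ q, fun j => bV.repr ⟨y, hy⟩ j, ?_⟩
    rw [hsumW, hsumV, bW.sum_repr, bV.sum_repr, add_comm]
    exact hyz
  choose cW cV hc using hdec
  refine ⟨Module.finrank (ZMod p) W, Module.finrank (ZMod p) (vanSub Λ U₀), fun q i => combAt Λ (rowW q) i,
    fun j i => combAt Λ (rowV j) i, Fin.append rowW rowV,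
    fun i => Fin.append (cW (Pi.single i 1)) (cV (Pi.single i 1)), ?_, ?_, ?_, ?_, ?_⟩
  · have h := Submodule.finrank_sup_add_finrank_inf_eq (vanSub Λ U₀) W
    rw [hVW.sup_eq_top, hVW.inf_eq_bot, finrank_top, finrank_bot, add_zero, Module.finrank_fintype_fun_eq_card,
      Fintype.card_fin] at h
    omega
  · ext i l
    rw [Matrix.mul_apply, Fin.sum_univ_add]
    simp only [Fin.append_left, Fin.append_right]
    have h := congrFun (hc (Pi.single i 1)) l
    simp only [Pi.add_apply, Finset.sum_apply, Pi.smul_apply, smul_eq_mul] at h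
    rw [h, Matrix.one_apply, Pi.single_apply]
    by_cases hil : i = l
    · subst hil; simp
    · rw [if_neg (Ne.symm hil), if_neg hil]
  · funext j i
    induction j using Fin.addCases with
    | left q => simp only [Fin.append_left]; rfl
    | right j' => simp only [Fin.append_right]; rfl
  · intro j i hi
    exact (bV j).2 i hi
  · intro a' ha'
    have hcval : ∀ i, combAt Λ ((∑ q, a' q • bW q : W) : Fin k → ZMod p) i = ∑ q, a' q * combAt Λ (rowW q) i := by
      intro i
      rw [← hsumW, ← combAt_sum]
      congr 1
      funext l
      simp only [Finset.sum_apply, Pi.smul_apply, smul_eq_mul]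
    rcases hprep ((∑ q, a' q • bW q : W) : Fin k → ZMod p) with hvan | hwt
    · exfalso
      have hcV : ((∑ q, a' q • bW q : W) : Fin k → ZMod p) ∈ vanSub Λ U₀ := hvan
      have hcW : ((∑ q, a' q • bW q : W) : Fin k → ZMod p) ∈ W := (∑ q, a' q • bW q : W).2
      have hc0 : ((∑ q, a' q • bW q : W) : Fin k → ZMod p) = 0 := by
        have hmem : ((∑ q, a' q • bW q : W) : Fin k → ZMod p) ∈ vanSub Λ U₀ ⊓ W := ⟨hcV, hcW⟩
        rw [hVW.inf_eq_bot, Submodule.mem_bot] at hmem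
        exact hmem
      have hc0' : (∑ q, a' q • bW q : W) = 0 := by
        ext1
        exact hc0
      have hli := (Fintype.linearIndependent_iff.mp bW.linearIndependent) a' hc0'
      exact ha' (funext hli)
    · unfold wtOff at hwt
      simp_rw [hcval] at hwt
      exact hwt

end Puncture

end Summit.QuantumAdvantage.QuantumAdvantage.Theorems.LabelPreparation
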